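import Literature.NumberTheory.Automorphic.ArthurClozelFibresOfJacquetShalika
import Literature.NumberTheory.Automorphic.PairLFunctionPolesEqConjLeTwo
import HarnessLib

/-!
# Arthur–Clozel, Ch. 3, Thm. 3.1 (quadratic case) rank by rank, and at rank 2 from the `GL₂` leaves

Topic `NumberTheory/Automorphic`; namespace `Literature.NumberTheory.Automorphic`. Proof file (theorems
only: no definition, no named fact), sibling of `ArthurClozelFibresRepData` /
`ArthurClozelFibresOfJacquetShalika`, which derive the all-rank named fact
`ArthurClozel_fibres_quadratic` of `TunnellLemma` (Arthur–Clozel 1989, Ch. 3, Thm. 3.1 for a quadratic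
extension `M/K`, at the level of Hecke matrices almost everywhere, for cuspidal automorphic
representations of `GL_n(𝔸_K)` in the Borel–Jacquet model) from Jacquet–Shalika (2.2)–(2.3) and
multiplicity one IN EVERY RANK.  Consumers at a fixed rank (`n = 2`: the quadratic base-change arguments
for `GL₂` — Tunnell, Langlands–Tunnell, the icosahedral descent of route ParityBlindBianchi) are thereby
charged for the general-rank analytic theory.  This file proves the SAME reduction with the rank pinned:

* `ArthurClozel_fibres_quadratic_rank_of_leaves` — Thm. 3.1 for `GL_n`, `n ≥ 1` fixed, from (2.2) at
  `s = 1` and on the line `re s = 1`, (2.3) and multiplicity one AT THAT RANK (the body of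
  `ArthurClozel_fibres_quadratic_of_normalisation` with `intro n` removed; (2.1)
  `JacquetShalika1981_multipliable_partialPairL_holds`, the automorphic measure
  `AdelicGroupData.exists_isAutomorphicMeasure_gl_holds`, the quadratic Hecke character
  `exists_heckeCharacter_quadraticSign_of_finrank_eq_two` and the unitary normalisation
  `CuspidalAutomorphicRepData.exists_satake_eq_cpow_mul_L2_unconditional` being theorems of the tree);
* `ArthurClozel_fibres_quadratic_two_of_leaves` — the rank-2 statement from the three `GL₂` leaves
  (2.2) at `s = 1`, (2.2′) on `re s = 1`, multiplicity one for `GL₂`: at rank 2 the pole (2.3) is the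
  tree's theorem `JacquetShalika1981_partialPairL_pole_of_eq_conj_holds_of_le_two` (Kirillov first
  moment).

## References

* J. Arthur, L. Clozel, *Simple algebras, base change, and the advanced theory of the trace
  formula*, Ann. of Math. Stud. 120 (1989), Ch. 3 §2 (2.1)–(2.3) (p. 200), Thm. 3.1 and its proof
  (p. 201). [ArthurClozelAMS120]
* H. Jacquet, J. A. Shalika, *On Euler products and the classification of automorphic forms II*,
  Amer. J. Math. 103 (1981), 777–815, Prop. 3.6. [JacquetShalikaAJM1981II]
* R. P. Langlands, *Base change for GL(2)*, Ann. of Math. Stud. 96 (1980). [LanglandsBaseChange1980]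
-/

noncomputable section

open scoped MatrixGroups NNReal Classical
open NumberField IsDedekindDomain MeasureTheory Filter

namespace Literature.NumberTheory.Automorphic

open AdelicGroupData
open Literature.NumberTheory.GaloisRepresentations (HeckeCharacter ideleGroup)

/-- **Arthur–Clozel, Ch. 3, Thm. 3.1 (quadratic case, Borel–Jacquet data) at a FIXED rank `n ≥ 1`
from the leaves at that rank.**  Granting, for `GL_n` over all number fields and all automorphic
measures, Jacquet–Shalika (2.2) at `s = 1` (`h22`) and on the boundary line (`h22'`), (2.3) (`h23`)
and multiplicity one on `L²_cusp(GL_n)` (`hm1`) — the tree's named facts, at rank `n` only —: for a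
quadratic extension `M/K` and cuspidal automorphic representations `π, π'` of `GL_n(𝔸_K)` (arbitrary
central characters) with `t_{π,w}^{f(x|w)} = t_{π',w}^{f(x|w)}` for almost all places `x` of `M`,
either `t_{π'} = t_π` almost everywhere or `t_{π',w} = ε_{M/K}(w) t_{π,w}` almost everywhere.  Proof:
verbatim the body of `ArthurClozel_fibres_quadratic_of_normalisation` at rank `n` — "We may assume
`π, π'` unitary" (`CuspidalAutomorphicRepData.exists_satake_eq_cpow_mul_L2_unconditional`:
`t_π = q^{s} t_P`, `t_{π'} = q^{s'} t_{P'}`), `re s = re s'` (`re_eq_zero_of_map_pow_eq_shift`), and the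
`L²` theorem up to the unitary shift (`ArthurClozel_fibres_quadratic_L2_of_shift_of_character`), with
(2.1) `JacquetShalika1981_multipliable_partialPairL_holds`, the automorphic measure
`exists_isAutomorphicMeasure_gl_holds` and `η_{M/K}` `exists_heckeCharacter_quadraticSign_of_finrank_eq_two`
supplied by theorems. [cite: ArthurClozelAMS120, Ch. 3, Thm. 3.1 and its proof (p. 201)] -/
theorem ArthurClozel_fibres_quadratic_rank_of_leaves {n : ℕ} (hn : 0 < n)
    (h22 : ∀ {K : Type} [Field K] [NumberField K] {μ : Measure (gl n K).automorphicQuotient}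
      [(gl n K).IsAutomorphicMeasure μ],
      JacquetShalika1981_partialPairL_at_one_of_ne_conj (n := n) (K := K) (μ := μ))
    (h22' : ∀ {K : Type} [Field K] [NumberField K] {μ : Measure (gl n K).automorphicQuotient}
      [(gl n K).IsAutomorphicMeasure μ],
      JacquetShalika1981_partialPairL_boundary_of_ne_one (n := n) (m := n) (K := K) (μ := μ) (μ' := μ))
    (h23 : ∀ {K : Type} [Field K] [NumberField K] {μ : Measure (gl n K).automorphicQuotient}
      [(gl n K).IsAutomorphicMeasure μ],
      JacquetShalika1981_partialPairL_pole_of_eq_conj (n := n) (K := K) (μ := μ))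
    (hm1 : ∀ (K : Type) [Field K] [NumberField K] (μ : Measure (gl n K).automorphicQuotient)
      [(gl n K).IsAutomorphicMeasure μ], multiplicity_one_gl n K μ)
    (K M : Type) [Field K] [NumberField K] [Field M] [NumberField M] [Algebra K M]
    (hKM : Module.finrank K M = 2) (hK : isCompact_glFiniteIntegralLevel n K)
    (π π' : CuspidalAutomorphicRepData n K hK)
    (hyp : ∀ᶠ x : HeightOneSpectrum (𝓞 M) in Filter.cofinite,
      ∀ (w : HeightOneSpectrum (𝓞 K)) (α α' : Multiset ℂ), x.asIdeal.under (𝓞 K) = w.asIdeal →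
        π.1.HasSatakeParamAt w α → π'.1.HasSatakeParamAt w α' →
          α.map (· ^ x.asIdeal.inertiaDeg (𝓞 K)) = α'.map (· ^ x.asIdeal.inertiaDeg (𝓞 K))) :
    (∀ᶠ w : HeightOneSpectrum (𝓞 K) in Filter.cofinite, ∀ α : Multiset ℂ,
        π.1.HasSatakeParamAt w α → π'.1.HasSatakeParamAt w α) ∨
    (∀ᶠ w : HeightOneSpectrum (𝓞 K) in Filter.cofinite, ∀ α : Multiset ℂ,
        π.1.HasSatakeParamAt w α → π'.1.HasSatakeParamAt w (α.map (quadraticSign M w * ·))) := by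
  haveI : NeZero n := ⟨hn.ne'⟩
  obtain ⟨μm, hμm⟩ := AdelicGroupData.exists_isAutomorphicMeasure_gl_holds n K
  haveI := hμm
  -- unitary normalisations of `π` and `π'`
  obtain ⟨s, P, S, αP, hS, hαP, hiff⟩ :=
    CuspidalAutomorphicRepData.exists_satake_eq_cpow_mul_L2_unconditional hK μm π
  obtain ⟨s', P', S', αP', hS', hαP', hiff'⟩ :=
    CuspidalAutomorphicRepData.exists_satake_eq_cpow_mul_L2_unconditional hK μm π'
  -- the exceptional places
  set E : Set (HeightOneSpectrum (𝓞 M)) := {x | ¬ ∀ (w : HeightOneSpectrum (𝓞 K)) (α α' : Multiset ℂ),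
      x.asIdeal.under (𝓞 K) = w.asIdeal → π.1.HasSatakeParamAt w α → π'.1.HasSatakeParamAt w α' →
        α.map (· ^ x.asIdeal.inertiaDeg (𝓞 K)) = α'.map (· ^ x.asIdeal.inertiaDeg (𝓞 K))} with hE
  have hEfin : E.Finite := Filter.eventually_cofinite.1 hyp
  set T : Set (HeightOneSpectrum (𝓞 K)) := S ∪ S' ∪ ((fun x : HeightOneSpectrum (𝓞 M) => x.under (𝓞 K)) '' E)
    with hT
  have hTfin : T.Finite := (hS.union hS').union (hEfin.image _)
  have hST : S ⊆ T := fun w hw => Or.inl (Or.inl hw)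
  have hS'T : S' ⊆ T := fun w hw => Or.inl (Or.inr hw)
  -- the shifted relation `α_P(w)^{(f)} = (q^{s'-s} α_{P'}(w))^{(f)}` for all `x ∣ w ∉ T`
  have hrel0 : ∀ w ∉ T, ∀ x : HeightOneSpectrum (𝓞 M), x.asIdeal.under (𝓞 K) = w.asIdeal →
      (αP w).map (· ^ x.asIdeal.inertiaDeg (𝓞 K)) =
        ((αP' w).map (((w.residueCard : ℂ) ^ (s' - s)) * ·)).map (· ^ x.asIdeal.inertiaDeg (𝓞 K)) := by
    intro w hw x hx
    have hxE : x ∉ E := fun hxE => hw (Or.inr ⟨x, hxE, HeightOneSpectrum.ext hx⟩)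
    simp only [hE, Set.mem_setOf_eq, not_not] at hxE
    have hq : (w.residueCard : ℂ) ≠ 0 := by
      have := w.one_lt_residueCard; exact_mod_cast (by omega : w.residueCard ≠ 0)
    have h := hxE w _ _ hx ((hiff w (fun h => hw (hST h)) _).2 rfl) ((hiff' w (fun h => hw (hS'T h)) _).2 rfl)
    have hcne : (w.residueCard : ℂ) ^ s ≠ 0 := fun h0 => hq ((Complex.cpow_eq_zero_iff _ _).1 h0).1
    have h' := map_pow_eq_map_div_map_pow hcne _ h
    rwa [← Complex.cpow_sub _ _ hq] at h'
  -- if every place is exceptional there is nothing to prove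
  by_cases hex : ∃ w₀, w₀ ∉ T
  swap
  · simp only [not_exists, not_not] at hex
    left
    exact Filter.eventually_cofinite.2 (hTfin.subset fun w _ => hex w)
  -- `re s = re s'`: unitarity of the central characters of `P`, `P'` at one place
  obtain ⟨w₀, hw₀⟩ := hex
  obtain ⟨x₀, hx₀⟩ := exists_above (E := M) w₀
  have hre : (s' - s).re = 0 := by
    have hrel := hrel0 w₀ hw₀ x₀ hx₀
    obtain ⟨𝔫, -, -, ϖ, hSat⟩ := hαP w₀ (fun h => hw₀ (hST h))
    obtain ⟨𝔫', -, -, ϖ', hSat'⟩ := hαP' w₀ (fun h => hw₀ (hS'T h))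
    have hf : 0 < x₀.asIdeal.inertiaDeg (𝓞 K) := by
      rcases inertiaDeg_eq_one_or_two_of_finrank_eq_two hKM w₀ x₀ hx₀ with h | h <;> omega
    refine re_eq_zero_of_map_pow_eq_shift w₀.one_lt_residueCard hf ?_ hSat.norm_prod_eq_one
      hSat'.norm_prod_eq_one hrel
    rw [hSat'.card_eq]; exact NeZero.ne n
  set τ : ℝ := (s' - s).im with hτ
  have hsτ : s' - s = (τ : ℂ) * Complex.I := by
    apply Complex.ext
    · simp [hre]
    · simp [hτ]
  -- the `L²` theorem up to the unitary shift `q^{iτ}`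
  have hrel : ∀ w ∉ T, ∀ x : HeightOneSpectrum (𝓞 M), x.asIdeal.under (𝓞 K) = w.asIdeal →
      (αP w).map (· ^ x.asIdeal.inertiaDeg (𝓞 K)) =
        ((αP' w).map (((w.residueCard : ℂ) ^ ((τ : ℂ) * Complex.I)) * ·)).map
          (· ^ x.asIdeal.inertiaDeg (𝓞 K)) := by
    intro w hw x hx; rw [← hsτ]; exact hrel0 w hw x hx
  obtain ⟨ω, hωfin, hωM⟩ : ∃ ω : HeckeCharacter K, ω.IsFiniteOrder ∧
      ∀ᶠ w : HeightOneSpectrum (𝓞 K) in cofinite, ω.valueAtUniformizer w = quadraticSign M w := by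
    obtain ⟨ω, hωfin, hω⟩ := exists_heckeCharacter_quadraticSign_of_finrank_eq_two hKM
    exact ⟨ω, hωfin, hω.mono fun w hw => hw.2⟩
  obtain ⟨hτ0, T', hT'fin, hTT', hdich⟩ := ArthurClozel_fibres_quadratic_L2_of_shift_of_character hn
    JacquetShalika1981_multipliable_partialPairL_holds h22 h22' h23 (hm1 K μm) hKM ω hωfin hωM P P'
    hTfin (hαP.mono hST) (hαP'.mono hS'T) τ hrel
  -- hence `s' = s`
  have hss : s' = s := by
    have : s' - s = 0 := by rw [hsτ, hτ0, Complex.ofReal_zero, zero_mul]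
    exact sub_eq_zero.1 this
  have hnotT' : ∀ᶠ w : HeightOneSpectrum (𝓞 K) in cofinite, w ∉ T' := by
    rw [Filter.eventually_cofinite]
    simpa using hT'fin
  -- transport back to the Borel–Jacquet data
  rcases hdich with hA' | hB'
  · left
    filter_upwards [hnotT'] with w hw β hβ
    have hwS : w ∉ S := fun h => hw (hTT' (hST h))
    have hwS' : w ∉ S' := fun h => hw (hTT' (hS'T h))
    rw [(hiff w hwS β).1 hβ]
    exact (hiff' w hwS' _).2 (by rw [hA' w hw, hss])
  · right
    filter_upwards [hnotT'] with w hw β hβ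
    have hwS : w ∉ S := fun h => hw (hTT' (hST h))
    have hwS' : w ∉ S' := fun h => hw (hTT' (hS'T h))
    rw [(hiff w hwS β).1 hβ]
    refine (hiff' w hwS' _).2 ?_
    rw [hB' w hw, hss, Multiset.map_map, Multiset.map_map]
    exact Multiset.map_congr rfl fun a _ => by simp only [Function.comp_apply]; ring

/-- **Arthur–Clozel, Ch. 3, Thm. 3.1 for `GL₂` (fibres of quadratic base change; Langlands 1980) from
the three `GL₂` leaves**: Jacquet–Shalika (2.2) at `s = 1` (`h22`) and on `re s = 1` (`h22'`) and
multiplicity one for `GL₂` (`hm1`) — the tree's named facts at rank 2 only —, the pole (2.3) at rank 2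
being the tree's theorem `JacquetShalika1981_partialPairL_pole_of_eq_conj_holds_of_le_two` (Kirillov
first moment).  This is the `n := 2` slice of the named fact `ArthurClozel_fibres_quadratic`, with a
strictly smaller trust base than `ArthurClozel_fibres_quadratic_holds_of` (all ranks, four leaves).
[cite: ArthurClozelAMS120, Ch. 3, Thm. 3.1] -/
theorem ArthurClozel_fibres_quadratic_two_of_leaves
    (h22 : ∀ {K : Type} [Field K] [NumberField K] {μ : Measure (gl 2 K).automorphicQuotient}
      [(gl 2 K).IsAutomorphicMeasure μ],
      JacquetShalika1981_partialPairL_at_one_of_ne_conj (n := 2) (K := K) (μ := μ))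
    (h22' : ∀ {K : Type} [Field K] [NumberField K] {μ : Measure (gl 2 K).automorphicQuotient}
      [(gl 2 K).IsAutomorphicMeasure μ],
      JacquetShalika1981_partialPairL_boundary_of_ne_one (n := 2) (m := 2) (K := K) (μ := μ) (μ' := μ))
    (hm1 : ∀ (K : Type) [Field K] [NumberField K] (μ : Measure (gl 2 K).automorphicQuotient)
      [(gl 2 K).IsAutomorphicMeasure μ], multiplicity_one_gl 2 K μ)
    (K M : Type) [Field K] [NumberField K] [Field M] [NumberField M] [Algebra K M]
    (hKM : Module.finrank K M = 2) (hK : isCompact_glFiniteIntegralLevel 2 K)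
    (π π' : CuspidalAutomorphicRepData 2 K hK)
    (hyp : ∀ᶠ x : HeightOneSpectrum (𝓞 M) in Filter.cofinite,
      ∀ (w : HeightOneSpectrum (𝓞 K)) (α α' : Multiset ℂ), x.asIdeal.under (𝓞 K) = w.asIdeal →
        π.1.HasSatakeParamAt w α → π'.1.HasSatakeParamAt w α' →
          α.map (· ^ x.asIdeal.inertiaDeg (𝓞 K)) = α'.map (· ^ x.asIdeal.inertiaDeg (𝓞 K))) :
    (∀ᶠ w : HeightOneSpectrum (𝓞 K) in Filter.cofinite, ∀ α : Multiset ℂ,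
        π.1.HasSatakeParamAt w α → π'.1.HasSatakeParamAt w α) ∨
    (∀ᶠ w : HeightOneSpectrum (𝓞 K) in Filter.cofinite, ∀ α : Multiset ℂ,
        π.1.HasSatakeParamAt w α → π'.1.HasSatakeParamAt w (α.map (quadraticSign M w * ·))) :=
  ArthurClozel_fibres_quadratic_rank_of_leaves two_pos h22 h22'
    (fun {_} _ _ {_} _ => JacquetShalika1981_partialPairL_pole_of_eq_conj_holds_of_le_two le_rfl)
    hm1 K M hKM hK π π' hyp

end Literature.NumberTheory.Automorphic

end
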